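import Summits.CriticalPhenomena.PercolationContinuityZ3.Theorems.Transplant.SkelConcRoot
import Summits.CriticalPhenomena.PercolationContinuityZ3.Theorems.Transplant.KNCellsBoxProdZ2RootRun
import Summits.CriticalPhenomena.PercolationContinuityZ3.Theorems.Transplant.PlanarSkeletonPrisms
import HarnessLib

/-!
# L6 (R), file 2: the root residue `Skel.RootOblA` of the concentric scheme of record FROM THE PLANAR ROOT RUN — `Skel.rootOblA_concSG`
# (SkelConcRoot) with the straight-run WINDOW data `Skel.rootWAD` built on p2-g2's planar `rootCtr / rootρ / RootRunOK` (KNCellsBoxProdZ2RootRun,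
# pure `Site 2`, imported verbatim): admissibility, the rim parts inside the regions, the three planar facts AND the nonemptiness of the true
# targets are discharged; what remains per direction is `RootRunOKN`, three radius facts (+1 slack), `60 r ≤ Rt`, the level-window numerics,
# and the kit clauses / rim excess / first hop / count — generic twin of `KNCellsBoxProdZ2ConcRootRun` (`rootTAD`, `rootOblA_of_rootRun`)

builds on p205010 (kernel theorem, internal audit signed; external expert review pending) — nothing in this file uses p205010.
Status sentence (coordinator 2026-08-20T04:30Z): "θ(p_c) = 0 on ℤ^d, all d ≥ 2 — kernel-verified (Lean 4/Mathlib, standard axioms); internal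
adversarial audit SIGNED 2026-08-20 04:29Z; external expert review pending."
Lane `prim-bschramm-*`, seat `prim-bschramm-p2` (gen 4; (R) = p2 lineage, SHEAR-SCOPE §3.9 Layer 6); helper file (`--supports stmt-CriticalPhenomena-4575`).

DICTIONARY: `π := ballFin X w₀ Rt ↦ Rπ := Rt`; rim parts `(B(w₀,Rt) ∖ B(w₀,Rt−L')) ×ˢ region_k ↦ (Φ.Win w₀ region_k Rt).filter (· ∉ B_G(w₀, Rt−L'))`
(the shape `Skel.real_rim_le_of_radius` consumes: `Rim ⊆ D`, `∀ v ∈ Rim, v ∉ B_G(w₀, R − L')`); first-hop box `π₀ ×ˢ Bpl ↦ B₀ ⊆ Φ.Win w₀ Bpl Rt`.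
The ONE new planar clause is `RootRunOKN.htrN : |cb| + q' + 2t + 47R' + 1 ≤ 20t` (regions inside the NARROW between-box `C.BtwN`, transverse
half-width `5r − 1 = 20t − 1`; the standard parameters `cb = 0`, `q' = 3t`, `100R' ≤ t` of `rootRunOK_std` have slack `15t − 47R' − 1 ≥ 0`).
The true targets are nonempty once `Rt ≥ 60r`: a core point `x ∈ core_{k+1} ⊆ C.Cell 0 ∪ C.Cell (0+du)` has `|x_i| ≤ 30r`, so (ι) `step` gives a
vertex over it within depth `60r` (`PlanarSkeleton.exists_mem_graphBall_φ_eq`).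
* `RootRunOKN`, **`rootRun_region_subset_N`** (narrow form of `rootRun_region_subset`), `abs_apply_le_of_mem_Cells_root`;
* `Skel.rootWAD Φ w₀ Rt L' du t R' ℓ₀ ca cb q' Rlev N j₀ j₁ Sfin : WinAdvData V`;
* **`Skel.rootOblA_of_rootRunSG`**.
[cite: KozmaNitzan2024, §4 p. 28 ((32) at the root), Lemma 11 (pp. 22–23)]
-/

noncomputable section

open MeasureTheory ProbabilityTheory
open scoped ENNReal Classical

namespace Summit.CriticalPhenomena.PercolationContinuityZ3.Theorems

namespace Transplant

/-! ## §1 Planar: the root run inside the NARROW between-box -/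

namespace BoxProdZ2

open Literature.Probability.Percolation Literature.Probability.LatticeModels
open Literature.Probability.Percolation.KozmaNitzan
open Literature.Probability.Percolation.KozmaNitzan.Cells (oth oth_ne eq_oth_of_ne sgOf sgOf_sign stepVec_apply_fst stepVec_apply_oth)
open ChainPlanar

/-- **Admissible parameters of the root run, narrow form**: `RootRunOK` and the regions inside the NARROW between-box transversally.
[this work] -/
structure RootRunOKN (C : PCells) (t R' ℓ₀ : ℕ) (ca cb q' : ℤ) : Prop extends RootRunOK C t R' ℓ₀ ca cb q' where
  /-- the regions stay inside the narrow between-box transversally (`5r − 1 = 20t − 1`) -/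
  htrN : |cb| + q' + 2 * t + 47 * R' + 1 ≤ 20 * t

variable {C : PCells} {du : MDir} {t R' ℓ₀ : ℕ} {ca cb q' : ℤ} (h : RootRunOKN C t R' ℓ₀ ca cb q')
include h

/-- **Every region of the root run lies in `C.BtwN 0 du ∪ C.Q (0 + du)`** (`k ≤ 44`; narrow between-box).
[cite: KozmaNitzan2024, §4 p. 26 (E_{v,x}), Lemma 11 (p. 22: Ω)] -/
theorem rootRun_region_subset_N {k : ℕ} (hk : k ≤ 44) :
    Adv.region 0 (t : ℤ) (rootρ t R' q') du.1 (sgOf du) (rootCtr du ca cb) k ⊆ C.BtwN 0 du ∪ C.Q ((0 : Site 2) + stepVec du) := by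
  intro x hx
  have hxw := rootRun_region_subset h.toRootRunOK hk hx
  have hx' := Adv.region_subset_prism (sgOf_sign du) (rootCtr du ca cb) (rootRun_advOK h.toRootRunOK) hk hx
  rw [PCells.mem_psBox_iff] at hx'
  simp only [rootCtr_fst, rootCtr_oth, sg_mul_sub] at hx'
  obtain ⟨-, hb1, hb2⟩ := hx'
  have htr := h.htrN
  unfold rootρ at hb1 hb2
  have hcb := le_abs_self cb
  have hcb' := neg_abs_le cb
  rcases Finset.mem_union.1 hxw with hB | hQ
  · -- inside the wide between-box: the level is right, the transverse coordinate is narrow by `htrN`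
    refine Finset.mem_union_left _ ?_
    rw [PCells.Btw, PCells.mem_psBox_iff] at hB
    rw [PCells.BtwN, PCells.mem_psBox_iff]
    simp only [cen_zero_apply, sub_zero] at hB ⊢
    have hr := h.hr
    refine ⟨hB.1, ?_, ?_⟩ <;> linarith
  · exact Finset.mem_union_right _ hQ

omit h in
/-- A point of `C.Cell 0 ∪ C.Cell (0 + du)` has coordinates of size `≤ 30r`. [folklore] -/
theorem abs_apply_le_of_mem_Cells_root (C : PCells) (du : MDir) {x : Site 2}
    (hx : x ∈ C.Cell 0 ∪ C.Cell ((0 : Site 2) + stepVec du)) (i : Fin 2) : |x i| ≤ 30 * (C.r : ℤ) := by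
  have hr : (0 : ℤ) ≤ C.r := by positivity
  rcases Finset.mem_union.1 hx with h | h
  · rw [PCells.Cell, C.mem_sq_iff] at h
    have := h i
    simp only [PCells.cen_apply, Pi.zero_apply, mul_zero] at this
    push_cast at this
    rw [abs_le]; constructor <;> linarith
  · rw [PCells.Cell, C.mem_sq_iff] at h
    have := h i
    simp only [PCells.cen_apply, zero_add] at this
    push_cast at this
    have hsv : |stepVec du i| ≤ 1 := by
      by_cases hi : i = du.1
      · subst hi; rw [stepVec_apply_fst]; rcases sgOf_sign du with hs | hs <;> simp [hs]
      · rw [eq_oth_of_ne hi, stepVec_apply_oth]; simp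
    rw [abs_le] at hsv ⊢
    constructor <;> nlinarith [hsv.1, hsv.2, this.1, this.2]

omit h in
/-- A point of `C.BtwN 0 du ∪ C.Q (0 + du)` has ℓ¹-norm `≤ 60r`. [folklore] -/
theorem natAbs_add_le_of_mem_root_region (C : PCells) (du : MDir) {x : Site 2}
    (hx : x ∈ C.BtwN 0 du ∪ C.Q ((0 : Site 2) + stepVec du)) : (x 0).natAbs + (x 1).natAbs ≤ 60 * C.r := by
  have hx' : x ∈ C.Cell 0 ∪ C.Cell ((0 : Site 2) + stepVec du) := by
    rcases Finset.mem_union.1 hx with h | h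
    · exact C.BtwN_subset_Cells 0 du h
    · exact Finset.mem_union_right _ (C.Q_subset_Cell _ h)
  have h0 := abs_apply_le_of_mem_Cells_root C du hx' 0
  have h1 := abs_apply_le_of_mem_Cells_root C du hx' 1
  rw [← Int.natCast_natAbs] at h0 h1
  omega

end BoxProdZ2

/-! ## §2 The straight-run window data of the root probe -/

namespace Skel

open Literature.Probability.Percolation Literature.Probability.LatticeModels SimpleGraph GadgetSystem ProbeHistory HSiteScheme Contour KNCells
open KNCells.KSchA PlanarSkeletonConc
open Literature.Probability.Percolation.KozmaNitzan.Cells (sgOf sgOf_sign)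
open Literature.Barriers.CriticalPhenomena (graphBall mem_graphBall_self graphBall_mono)
open BoxProdZ2 (ConcRadiiG rootρ rootCtr RootRunOK RootRunOKN rootRun_advOK rootRun_region_subset_N rootRun_region_disjoint_Q
  rootRun_last_subset_M natAbs_add_le_of_mem_root_region)

variable {V : Type} {G : SimpleGraph V} [G.LocallyFinite] (Φ : PlanarSkeletonConc G)

/-- **The straight-run window data of the root probe** in direction `du` over the window of depth `Rt` about `w₀`: `q = 0`, `s₁ = t`,
`ρ = rootρ t R' q'`, `nA = 44`, axis `du.1`, sign `sgOf du`, centre `rootCtr du ca cb`, source `w₀`, rim parts = the region windows' vertices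
deeper than `Rt − L'`. [cite: KozmaNitzan2024, §4 p. 28, Lemma 11] -/
def rootWAD (w₀ : V) (Rt L' : ℕ) (du : MDir) (t R' ℓ₀ : ℕ) (ca cb q' : ℤ) (Rlev N j₀ j₁ : ℕ) (Sfin : Finset V) : WinAdvData V where
  Rπ := Rt
  q := 0
  q' := q'
  s₁ := t
  ρ := rootρ t R' q'
  R' := R'
  ℓ₀ := ℓ₀
  nA := 44
  ax := du.1
  sg := sgOf du
  c := rootCtr du ca cb
  Rlev := Rlev
  N := N
  j₀ := j₀
  j₁ := j₁
  root := w₀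
  Sfin := Sfin
  Rim := fun k => (Φ.Win w₀ (ChainPlanar.Adv.region 0 (t : ℤ) (rootρ t R' q') du.1 (sgOf du) (rootCtr du ca cb) k) Rt).filter
    fun v => v ∉ graphBall G w₀ (Rt - L')

/-- The rim parts lie in the regions. [folklore] -/
theorem rootWAD_Rim_subset (w₀ : V) (Rt L' : ℕ) (du : MDir) (t R' ℓ₀ : ℕ) (ca cb q' : ℤ) (Rlev N j₀ j₁ : ℕ) (Sfin : Finset V) (k : ℕ) :
    (rootWAD Φ w₀ Rt L' du t R' ℓ₀ ca cb q' Rlev N j₀ j₁ Sfin).Rim k ⊆ (rootWAD Φ w₀ Rt L' du t R' ℓ₀ ca cb q' Rlev N j₀ j₁ Sfin).stepD Φ k :=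
  Finset.filter_subset _ _

/-- The rim parts are deeper than `Rt − L'`. [folklore] -/
theorem not_mem_graphBall_of_mem_rootWAD_Rim {w₀ : V} {Rt L' : ℕ} {du : MDir} {t R' ℓ₀ : ℕ} {ca cb q' : ℤ} {Rlev N j₀ j₁ : ℕ}
    {Sfin : Finset V} {k : ℕ} {v : V} (hv : v ∈ (rootWAD Φ w₀ Rt L' du t R' ℓ₀ ca cb q' Rlev N j₀ j₁ Sfin).Rim k) :
    v ∉ graphBall G w₀ (Rt - L') :=
  (Finset.mem_filter.1 hv).2

/-! ## §3 The root residue from the planar root run -/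

variable [DecidableEq V]

/-- **THE ROOT RESIDUE OF THE SCHEME OF RECORD FROM THE PLANAR ROOT RUN** (generic design (D), (R)).
[cite: KozmaNitzan2024, §4 p. 28 ((32) at the root), Lemma 11 (pp. 22–23)] -/
theorem rootOblA_of_rootRunSG (C : PCells) (w₀ : V) {Λ : ConcRadiiG} (hΛ : WFS C Λ) (hφ : Φ.φ w₀ = 0) (q : unitInterval) (δc : ℝ)
    {Δ' : ℕ} {δr : ℕ → ℝ} {Rt L' t R' ℓ₀ Rlev N j₀ j₁ : ℕ} {ca cb q' : MDir → ℤ}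
    (hOK : ∀ du, RootRunOKN C t R' ℓ₀ (ca du) (cb du) (q' du)) (hRl : Rlev + 1 ≤ R') (hj : j₁ ≤ Rlev)
    (P : MDir → WinAdvData V)
    (hP : ∀ du, P du = rootWAD Φ w₀ Rt L' du t R' ℓ₀ (ca du) (cb du) (q' du) Rlev N j₀ j₁
      (((⟨cellGeomSG Φ C w₀ Λ, q, δc⟩ : KSchA V ℕ).U0root du).filter fun y => y ∈ graphBall G w₀ Rt))
    -- three radius facts (one unit of slack) and the depth of the window over the planar extent of the run
    (hRB : ∀ du, Rt + 1 ≤ Λ.rB 0 0 du) (hRQ : ∀ du, Rt + 1 ≤ Λ.rQ 0 ((0 : Site 2) + stepVec du))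
    (hRM : ∀ du, Rt + 1 ≤ Λ.rM 0 ((0 : Site 2) + stepVec du)) (hRt : 60 * C.r ≤ Rt)
    -- the analytic inputs
    (hcount : ∀ du, 1 / (1 - (q : ℝ)) ^ (Δ' * (P du).N) ≤ δr (P du).nA * ((Finset.Icc (P du).j₀ (P du).j₁).card : ℝ))
    (hkits : ∀ du, ∀ k ≤ (P du).nA, ∀ j ∈ Finset.Icc (P du).j₀ (P du).j₁, ∃ (σ : KNLevels.SData V) (Sz : Finset V),
      KNLevels.SHyp (winLData Φ (P du).root (P du).Rπ ((P du).alo k) ((P du).ahi k) (P du).root (P du).Sfin) j σ ∧ σ.N ≤ (P du).N ∧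
      (1 - (q : ℝ) ^ σ.sB) ^ σ.k ≤ δr (P du).nA ∧
      Sz ⊆ (winLData Φ (P du).root (P du).Rπ ((P du).alo k) ((P du).ahi k) (P du).root (P du).Sfin).X j ∧ Sz ⊆ (P du).stepD Φ k ∧
      (∀ x ∈ σ.K, ∀ e' ∈ σ.seed x, e' ∉ wireSet (↑Sz : Set V)) ∧ (∀ x ∈ σ.K, σ.face x ⊆ Sz) ∧
      (∀ x ∈ σ.K, 1 - 3 * δr (P du).nA ≤ (prodBernoulli ((⟨cellGeomSG Φ C w₀ Λ, q, δc⟩ : KSchA V ℕ).W0sub G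
          (((⟨cellGeomSG Φ C w₀ Λ, q, δc⟩ : KSchA V ℕ).U0root du).filter fun y => y ∈ graphBall G w₀ Rt))).real {ω | ∃ u ∈ σ.face x,
        1 - δr (P du).nA < (prodBernoulli (pinW ((⟨cellGeomSG Φ C w₀ Λ, q, δc⟩ : KSchA V ℕ).W0sub G
          (((⟨cellGeomSG Φ C w₀ Λ, q, δc⟩ : KSchA V ℕ).U0root du).filter fun y => y ∈ graphBall G w₀ Rt))
          (wireSet (↑Sz : Set V)) ω)).real
          (⋃ t' ∈ (P du).coreE Φ k, openConnIn (↑((P du).stepD Φ k) : Set V) u t')}))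
    {η : ℝ} (hη : ∀ du, η ≤ δr (P du).nA / 2)
    (hexc : ∀ du, ∀ k ≤ (P du).nA, (prodBernoulli ((⟨cellGeomSG Φ C w₀ Λ, q, δc⟩ : KSchA V ℕ).W0sub G
        (((⟨cellGeomSG Φ C w₀ Λ, q, δc⟩ : KSchA V ℕ).U0root du).filter fun y => y ∈ graphBall G w₀ Rt))).real
        (⋃ t' ∈ (P du).Rim k, openConn w₀ t') ≤ η)
    {B₀ : MDir → Finset V} {Bpl : MDir → Finset (Site 2)}
    (hB₀ : ∀ du, B₀ du ⊆ Φ.Win w₀ (Bpl du) Rt) (hBpl : ∀ du, Bpl du ⊆ (P du).acore 0)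
    (hsrc : ∀ du, 1 - δr (P du).nA < (prodBernoulli ((⟨cellGeomSG Φ C w₀ Λ, q, δc⟩ : KSchA V ℕ).W0sub G
        (((⟨cellGeomSG Φ C w₀ Λ, q, δc⟩ : KSchA V ℕ).U0root du).filter fun y => y ∈ graphBall G w₀ Rt))).real
        (⋃ t' ∈ B₀ du, openConn w₀ t')) :
    RootOblA Φ (⟨cellGeomSG Φ C w₀ Λ, q, δc⟩ : KSchA V ℕ) Δ' δr := by
  have hRπ : ∀ du, (P du).Rπ = Rt := fun du => by rw [hP]; rfl
  have hroot : ∀ du, (P du).root = w₀ := fun du => by rw [hP]; rfl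
  have hsg : ∀ du, (P du).sg = 1 ∨ (P du).sg = -1 := fun du => by rw [hP]; exact sgOf_sign du
  have hAOK : ∀ du, ChainPlanar.Adv.AdvOK (P du).q (P du).q' (P du).s₁ (P du).ρ (P du).R' (P du).ℓ₀ (P du).nA :=
    fun du => by rw [hP]; exact rootRun_advOK (hOK du).toRootRunOK
  -- the three planar facts
  have hreg : ∀ du, ∀ k ≤ (P du).nA, (P du).aregion k ⊆ C.BtwN 0 du ∪ C.Q ((0 : Site 2) + stepVec du) := by
    intro du k hk; rw [hP] at hk ⊢; exact rootRun_region_subset_N (hOK du) hk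
  have hQ0 : ∀ du, ∀ k ≤ (P du).nA, Disjoint ((P du).aregion k) (C.Q 0) := by
    intro du k hk; rw [hP] at hk ⊢; exact rootRun_region_disjoint_Q (hOK du).toRootRunOK hk
  have hlast : ∀ du, (P du).acore ((P du).nA + 1) ⊆ C.M ((0 : Site 2) + stepVec du) := by
    intro du; rw [hP]; exact rootRun_last_subset_M (hOK du).toRootRunOK
  refine rootOblA_concSG Φ C w₀ hΛ hφ q δc P B₀ (fun _ => η) hroot (fun du => by rw [hP]; rfl) hsg hAOK
    (fun du => by rw [hP]; exact hRl) (fun du k => by rw [hP]; exact rootWAD_Rim_subset Φ ..) (fun du => by rw [hP]; exact hj)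
    (fun du k hk => ?_) (fun du => by rw [hRπ]; exact hRB du) (fun du => by rw [hRπ]; exact hRQ du) (fun du => by rw [hRπ]; exact hRM du)
    hreg hQ0 hlast hcount (fun du k hk j hjj => ?_) hη (fun du k hk => ?_) (fun du => ?_) (fun du => ?_)
  · -- the true targets are nonempty: a core point lies under a vertex of depth `≤ 60r ≤ Rt` (field (ι) `step`)
    obtain ⟨x, hx⟩ := WinAdvData.acore_nonempty (hsg du) (hAOK du) (k + 1)
    have hxr : x ∈ C.BtwN 0 du ∪ C.Q ((0 : Site 2) + stepVec du) :=
      hreg du k hk (ChainPlanar.Adv.core_succ_subset_region (hsg du) (P du).c (hAOK du) hk hx)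
    obtain ⟨g, hg, hφg⟩ := PlanarSkeleton.exists_mem_graphBall_φ_eq Φ.toPlanarSkeleton Φ.step w₀ x
    simp only [hφ, Pi.zero_apply, sub_zero] at hg
    refine WinAdvData.coreT_nonempty_of Φ (v := g) ?_ (by rw [show Φ.φ g = x from hφg]; exact hx)
    rw [hroot, hRπ]
    exact graphBall_mono G w₀ ((natAbs_add_le_of_mem_root_region C du hxr).trans hRt) hg
  · -- the kit clauses (window depth `Rπ = Rt`)
    have h := hkits du k hk j hjj
    rw [hRπ] at h ⊢
    exact h
  · -- the rim excess
    rw [hRπ]; exact hexc du k hk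
  · -- the first-hop box lies in the first level
    rw [WinAdvData.stepL_X_zero _ _ (hsg du), hroot, hRπ]
    exact (hB₀ du).trans (Φ.Win_mono (hBpl du) le_rfl)
  · -- the first hop
    rw [hRπ]; exact hsrc du

end Skel

end Transplant

end Summit.CriticalPhenomena.PercolationContinuityZ3.Theorems

end
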